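import Literature.NumberTheory.Sieve.LargestPrimeFactorCubicMertens
import HarnessLib

/-!
# Heath-Brown 2001, Lemma 2.2 (the Chebyshev–Hooley step) — III: `∑_n log^{(1)}(n³+2) ≤ X log X + O(X)`

Topic `Literature/NumberTheory/Sieve`; third file of the proof of Heath-Brown's Lemma 2.2
(A. J. Irving, arXiv:1412.0024, Lemma 2.2; statement and plan in `LargestPrimeFactorCubicLocal`).
Everything here is PROVED; no named facts.

With `ν(q) = #{r < q : q ∣ r³ + 2}`, `N(q) = #{X < n ≤ 2X : q ∣ n³ + 2}` and
`log^{(1)}(n³+2) = ∑_{p ≤ 3X} v_p(n³+2) log p`: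

* `sum_factorization_eq_sum_card` : `∑_{X<n≤2X} v_p(n³+2) = ∑_{e ≥ 1} N(p^e)`;
* `log_mul_sum_card_le` : per prime, `log p ∑_e N(p^e) ≤ X ν(p) log p/p + 2ν(p) log p +
  3X log p/(p(p−1)) + 6 log(8X³+2)` (`N(p^e) ≤ ν(p^e)(X/p^e + 2)`, `ν(p^e) ≤ 3`, from `…Local`);
* `sum_smoothLog_le` : **`∑_{X<n≤2X} log^{(1)}(n³+2) ≤ X log X + K X`** (`X ≥ 2`), summing the
  per-prime bound with `∑_{p≤x} ν(p) log p/p ≤ log x + O(1)` and `θ_ν(x) = x + O(x/log²x)`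
  (prime ideal theorem, `…Mertens`), `∑_p log p/(p(p−1)) ≤ 2` (tree) and `π(x) log x ≤ 5x`.

## References

* D. R. Heath-Brown, Proc. London Math. Soc. (3) 82 (2001) 554–596. [`HeathBrown2001LargestPrimeFactorCubic`]
* A. J. Irving, arXiv:1412.0024 (Acta Arith. 171 (2015)), §2, Lemma 2.2. [`Irving2014LargestPrimeFactorCubic`]
-/

noncomputable section

open Finset Real

namespace Literature.NumberTheory.Sieve.LargestPrimeFactorCubic

open Literature.NumberTheory.LFunctions

/-! ### `∑_n v_p(n³ + 2)` through the counts `N(p^e)` -/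

/-- `∑_{X<n≤2X} v_p(n³+2) = ∑_{1 ≤ e < E} N(p^e)` with `E = 8X³ + 3` (`n³ + 2 < 2^E ≤ p^E`), where
`N(q) = #{X < n ≤ 2X : q ∣ n³ + 2}`. [folklore] -/
theorem sum_factorization_eq_sum_card (X : ℕ) {p : ℕ} (hp : p.Prime) :
    ∑ n ∈ Ioc X (2 * X), (n ^ 3 + 2).factorization p =
      ∑ e ∈ Ico 1 (8 * X ^ 3 + 3), #{n ∈ Ioc X (2 * X) | p ^ e ∣ n ^ 3 + 2} := by
  have hE : ∀ n ∈ Ioc X (2 * X), n ^ 3 + 2 < p ^ (8 * X ^ 3 + 3) := by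
    intro n hn
    obtain ⟨-, h2, -⟩ := cube_add_two_bounds hn
    calc n ^ 3 + 2 < 8 * X ^ 3 + 3 := by omega
      _ < 2 ^ (8 * X ^ 3 + 3) := Nat.lt_two_pow_self
      _ ≤ p ^ (8 * X ^ 3 + 3) := Nat.pow_le_pow_left hp.two_le _
  calc ∑ n ∈ Ioc X (2 * X), (n ^ 3 + 2).factorization p
      = ∑ n ∈ Ioc X (2 * X), #{e ∈ Ico 1 (8 * X ^ 3 + 3) | p ^ e ∣ n ^ 3 + 2} :=
        sum_congr rfl fun n hn =>
          Nat.factorization_eq_card_pow_dvd_of_lt hp (by positivity) (hE n hn)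
    _ = ∑ n ∈ Ioc X (2 * X), ∑ e ∈ Ico 1 (8 * X ^ 3 + 3),
          (if p ^ e ∣ n ^ 3 + 2 then 1 else 0) := by simp_rw [card_filter]
    _ = ∑ e ∈ Ico 1 (8 * X ^ 3 + 3), ∑ n ∈ Ioc X (2 * X),
          (if p ^ e ∣ n ^ 3 + 2 then 1 else 0) := sum_comm
    _ = _ := by simp_rw [card_filter]

/-- **Per prime**: `log p · ∑_{1≤e<E} N(p^e) ≤ X·ν(p) log p/p + 2 ν(p) log p + 3X log p/(p(p−1)) +
6 log(8X³+2)` — `N(p) ≤ ν(p)(X/p + 2)`, `N(p^e) ≤ 3(X/p^e + 2)` for the `≤ log_p(8X³+2)`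
exponents `e ≥ 2` with `p^e ≤ 8X³ + 2`, and `N(p^e) = 0` beyond. [cite: Irving2014LargestPrimeFactorCubic, Lemma 2.2] -/
theorem log_mul_sum_card_le (X : ℕ) {p : ℕ} (hp : p.Prime) :
    Real.log p * ∑ e ∈ Ico 1 (8 * X ^ 3 + 3), (#{n ∈ Ioc X (2 * X) | p ^ e ∣ n ^ 3 + 2} : ℝ) ≤
      X * ((#{r ∈ range p | p ∣ r ^ 3 + 2} : ℝ) * Real.log p / p)
        + 2 * ((#{r ∈ range p | p ∣ r ^ 3 + 2} : ℝ) * Real.log p)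
        + 3 * X * (Real.log p / (p * (p - 1))) + 6 * Real.log ((8 * X ^ 3 + 2 : ℕ) : ℝ) := by
  set M := 8 * X ^ 3 + 2 with hM
  set ν : ℝ := (#{r ∈ range p | p ∣ r ^ 3 + 2} : ℝ) with hν
  have hp1 : (1 : ℝ) < p := by exact_mod_cast hp.one_lt
  have hp0 : (0 : ℝ) < p := by linarith
  have hlogp : 0 < Real.log p := Real.log_pos hp1
  -- `e = 1`
  have h1 : (#{n ∈ Ioc X (2 * X) | p ^ 1 ∣ n ^ 3 + 2} : ℝ) ≤ ν * (X / p + 2) := by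
    have h := card_dvd_Ioc_le X hp.pos
    rw [pow_one]
    calc (#{n ∈ Ioc X (2 * X) | p ∣ n ^ 3 + 2} : ℝ)
        ≤ ((#{r ∈ range p | p ∣ r ^ 3 + 2} * (X / p + 2) : ℕ) : ℝ) := by exact_mod_cast h
      _ = ν * (((X / p : ℕ) : ℝ) + 2) := by rw [hν]; push_cast; ring
      _ ≤ ν * (X / p + 2) := by
          gcongr
          exact Nat.cast_div_le
  -- `e ≥ 2`, pointwise
  have h2 : ∀ e ∈ Ico 2 (M + 1), (#{n ∈ Ioc X (2 * X) | p ^ e ∣ n ^ 3 + 2} : ℝ) ≤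
      3 * X * (1 / (p : ℝ)) ^ e + 6 * (if p ^ e ≤ M then 1 else 0) := by
    intro e _
    split_ifs with hle
    · have h := card_dvd_Ioc_le X (pow_pos hp.pos e)
      have h3 := rootCount_primePow_le_three hp e
      calc (#{n ∈ Ioc X (2 * X) | p ^ e ∣ n ^ 3 + 2} : ℝ)
          ≤ ((#{r ∈ range (p ^ e) | p ^ e ∣ r ^ 3 + 2} * (X / p ^ e + 2) : ℕ) : ℝ) := by
            exact_mod_cast h
        _ ≤ ((3 * (X / p ^ e + 2) : ℕ) : ℝ) := by exact_mod_cast Nat.mul_le_mul_right _ h3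
        _ = 3 * ((X / p ^ e : ℕ) : ℝ) + 6 * 1 := by push_cast; ring
        _ ≤ 3 * ((X : ℝ) * (1 / (p : ℝ)) ^ e) + 6 * 1 := by
            gcongr
            calc ((X / p ^ e : ℕ) : ℝ) ≤ (X : ℝ) / ((p ^ e : ℕ) : ℝ) := Nat.cast_div_le
              _ = X * (1 / (p : ℝ)) ^ e := by rw [Nat.cast_pow, one_div_pow, mul_one_div]
        _ = 3 * X * (1 / (p : ℝ)) ^ e + 6 * 1 := by ring
    · have hgt : 8 * X ^ 3 + 2 < p ^ e := by rw [← hM]; omega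
      rw [card_dvd_Ioc_eq_zero hgt, Nat.cast_zero, mul_zero, add_zero]
      positivity
  -- the geometric series
  have hgeom : ∑ e ∈ Ico 2 (M + 1), (1 / (p : ℝ)) ^ e ≤ 1 / ((p : ℝ) * (p - 1)) := by
    have hx0 : (0 : ℝ) ≤ 1 / p := by positivity
    have hx1 : 1 / (p : ℝ) < 1 := by rw [div_lt_one hp0]; exact hp1
    calc ∑ e ∈ Ico 2 (M + 1), (1 / (p : ℝ)) ^ e ≤ (1 / (p : ℝ)) ^ 2 / (1 - 1 / p) :=
          geom_sum_Ico_le_of_lt_one hx0 hx1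
      _ = 1 / ((p : ℝ) * (p - 1)) := by
          have : (p : ℝ) - 1 ≠ 0 := by linarith
          field_simp
  -- the number of exponents `e ≥ 2` with `p^e ≤ M`, times `log p`
  have hcount : (#{e ∈ Ico 2 (M + 1) | p ^ e ≤ M} : ℝ) * Real.log p ≤ Real.log (M : ℝ) := by
    have hM0 : M ≠ 0 := by omega
    have hsub : {e ∈ Ico 2 (M + 1) | p ^ e ≤ M} ⊆ Icc 1 (Nat.log p M) := by
      intro e he
      rw [mem_filter, mem_Ico] at he
      rw [mem_Icc]
      exact ⟨by omega, Nat.le_log_of_pow_le hp.one_lt he.2⟩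
    have hcard : #{e ∈ Ico 2 (M + 1) | p ^ e ≤ M} ≤ Nat.log p M := by
      simpa using card_le_card hsub
    have hcard' : (#{e ∈ Ico 2 (M + 1) | p ^ e ≤ M} : ℝ) ≤ Nat.log p M := by exact_mod_cast hcard
    calc (#{e ∈ Ico 2 (M + 1) | p ^ e ≤ M} : ℝ) * Real.log p ≤ (Nat.log p M : ℝ) * Real.log p :=
          mul_le_mul_of_nonneg_right hcard' hlogp.le
      _ = Real.log ((p : ℝ) ^ Nat.log p M) := by rw [Real.log_pow]
      _ ≤ Real.log (M : ℝ) := by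
          refine Real.log_le_log (by positivity) ?_
          exact_mod_cast Nat.pow_log_le_self p hM0
  -- sum of the `e ≥ 2` terms
  have hsum2 : ∑ e ∈ Ico 2 (M + 1), (#{n ∈ Ioc X (2 * X) | p ^ e ∣ n ^ 3 + 2} : ℝ) ≤
      3 * X * (1 / ((p : ℝ) * (p - 1))) + 6 * #{e ∈ Ico 2 (M + 1) | p ^ e ≤ M} := by
    calc ∑ e ∈ Ico 2 (M + 1), (#{n ∈ Ioc X (2 * X) | p ^ e ∣ n ^ 3 + 2} : ℝ)
        ≤ ∑ e ∈ Ico 2 (M + 1), (3 * X * (1 / (p : ℝ)) ^ e + 6 * (if p ^ e ≤ M then 1 else 0)) :=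
          sum_le_sum h2
      _ = 3 * X * ∑ e ∈ Ico 2 (M + 1), (1 / (p : ℝ)) ^ e +
            6 * ∑ e ∈ Ico 2 (M + 1), (if p ^ e ≤ M then (1 : ℝ) else 0) := by
          rw [sum_add_distrib, mul_sum, mul_sum]
      _ ≤ 3 * X * (1 / ((p : ℝ) * (p - 1))) + 6 * #{e ∈ Ico 2 (M + 1) | p ^ e ≤ M} := by
          rw [sum_boole]
          gcongr
  -- assemble
  have hME : 8 * X ^ 3 + 3 = M + 1 := by rw [hM]
  rw [hME, sum_eq_sum_Ico_succ_bot (show 1 < M + 1 by omega)]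
  have hkey : (#{n ∈ Ioc X (2 * X) | p ^ 1 ∣ n ^ 3 + 2} : ℝ) +
        ∑ e ∈ Ico (1 + 1) (M + 1), (#{n ∈ Ioc X (2 * X) | p ^ e ∣ n ^ 3 + 2} : ℝ) ≤
      ν * (X / p + 2) + (3 * X * (1 / ((p : ℝ) * (p - 1))) +
        6 * #{e ∈ Ico 2 (M + 1) | p ^ e ≤ M}) := add_le_add h1 hsum2
  calc Real.log p * ((#{n ∈ Ioc X (2 * X) | p ^ 1 ∣ n ^ 3 + 2} : ℝ) +
          ∑ e ∈ Ico (1 + 1) (M + 1), (#{n ∈ Ioc X (2 * X) | p ^ e ∣ n ^ 3 + 2} : ℝ))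
      ≤ Real.log p * (ν * (X / p + 2) + (3 * X * (1 / ((p : ℝ) * (p - 1))) +
          6 * #{e ∈ Ico 2 (M + 1) | p ^ e ≤ M})) := mul_le_mul_of_nonneg_left hkey hlogp.le
    _ = X * (ν * Real.log p / p) + 2 * (ν * Real.log p) + 3 * X * (Real.log p / (p * (p - 1)))
          + 6 * ((#{e ∈ Ico 2 (M + 1) | p ^ e ≤ M} : ℝ) * Real.log p) := by ring
    _ ≤ X * (ν * Real.log p / p) + 2 * (ν * Real.log p) + 3 * X * (Real.log p / (p * (p - 1)))
          + 6 * Real.log (M : ℝ) := by gcongr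

/-- **`∑_{X<n≤2X} log^{(1)}(n³ + 2) ≤ X log X + K X`** for `X ≥ 2` (the averaged input of the
Chebyshev–Hooley method: prime ideal theorem + partial summation for the primes, `ν(p^e) ≤ 3`,
`∑ log p/(p(p−1)) ≤ 2` and Chebyshev's `π(x) log x ≤ 5x` for the prime powers).
[cite: Irving2014LargestPrimeFactorCubic, Lemma 2.2] -/
theorem sum_smoothLog_le :
    ∃ K : ℝ, ∀ X : ℕ, 2 ≤ X →
      ∑ n ∈ Ioc X (2 * X), ∑ p ∈ Nat.primesLE (3 * X),
          ((n ^ 3 + 2).factorization p : ℝ) * Real.log p ≤ X * Real.log X + K * X := by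
  obtain ⟨C, hC0, hθ⟩ := exists_abs_thetaNu_sub_le
  obtain ⟨K, hK⟩ := sum_rootCount_mul_log_div_le
  have hlog2 : 0 < Real.log 2 := Real.log_pos one_lt_two
  refine ⟨Real.log 3 + K + 6 * C / Real.log 2 ^ 2 + 282, fun X hX => ?_⟩
  set ν : ℕ → ℝ := fun p => (#{r ∈ range p | p ∣ r ^ 3 + 2} : ℝ) with hν
  set s := Nat.primesLE (3 * X) with hs
  have h3X : 2 ≤ 3 * X := by omega
  have hX0 : (0 : ℝ) < X := by exact_mod_cast (show 0 < X by omega)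
  -- swap the sums
  have hswap : ∑ n ∈ Ioc X (2 * X), ∑ p ∈ s, ((n ^ 3 + 2).factorization p : ℝ) * Real.log p =
      ∑ p ∈ s, Real.log p * ∑ e ∈ Ico 1 (8 * X ^ 3 + 3),
        (#{n ∈ Ioc X (2 * X) | p ^ e ∣ n ^ 3 + 2} : ℝ) := by
    rw [sum_comm]
    refine sum_congr rfl fun p hp => ?_
    have hp' := (Nat.mem_primesLE.1 hp).2
    rw [← Nat.cast_sum, ← sum_factorization_eq_sum_card X hp', Nat.cast_sum, mul_sum]
    exact sum_congr rfl fun n _ => by ring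
  rw [hswap]
  -- the four sums
  have hA : ∑ p ∈ s, ν p * Real.log p / p ≤ Real.log X + (Real.log 3 + K) := by
    have h := hK (3 * X) h3X
    rw [Nat.cast_mul, Nat.cast_ofNat, Real.log_mul (by norm_num) hX0.ne'] at h
    simpa only [hν, add_assoc, add_comm (Real.log 3)] using h
  have hB : ∑ p ∈ s, ν p * Real.log p ≤ 3 * X + 3 * C * X / Real.log 2 ^ 2 := by
    have h := (abs_le.1 (hθ (3 * X) h3X)).2
    have hlog : Real.log 2 ≤ Real.log ((3 * X : ℕ) : ℝ) :=
      Real.log_le_log two_pos (by exact_mod_cast h3X)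
    have h' : C * ((3 * X : ℕ) : ℝ) / Real.log ((3 * X : ℕ) : ℝ) ^ 2 ≤
        C * ((3 * X : ℕ) : ℝ) / Real.log 2 ^ 2 := by
      refine div_le_div_of_nonneg_left (by positivity) (pow_pos hlog2 2) ?_
      gcongr
    push_cast at h h' ⊢
    have : ∑ p ∈ s, ν p * Real.log p ≤ 3 * X + C * (3 * X) / Real.log 2 ^ 2 := by linarith
    calc ∑ p ∈ s, ν p * Real.log p ≤ 3 * X + C * (3 * X) / Real.log 2 ^ 2 := this
      _ = 3 * X + 3 * C * X / Real.log 2 ^ 2 := by ring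
  have hCs : ∑ p ∈ s, Real.log p / (p * (p - 1)) ≤ 2 := MertensBound.sum_log_div_mul_pred_le_two _
  have hD : (#s : ℝ) * Real.log ((8 * X ^ 3 + 2 : ℕ) : ℝ) ≤ 45 * X := by
    rw [hs, Nat.primesLE_card_eq_primeCounting]
    have hπ := primeCounting_mul_log_le h3X
    have hM : ((8 * X ^ 3 + 2 : ℕ) : ℝ) ≤ ((3 * X : ℕ) : ℝ) ^ 3 := by
      have : 8 * X ^ 3 + 2 ≤ (3 * X) ^ 3 := by
        have : 1 ≤ X ^ 3 := Nat.one_le_pow _ _ (by omega)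
        nlinarith
      exact_mod_cast this
    have hlogM : Real.log ((8 * X ^ 3 + 2 : ℕ) : ℝ) ≤ 3 * Real.log ((3 * X : ℕ) : ℝ) := by
      calc Real.log ((8 * X ^ 3 + 2 : ℕ) : ℝ) ≤ Real.log (((3 * X : ℕ) : ℝ) ^ 3) :=
            Real.log_le_log (by positivity) hM
        _ = 3 * Real.log ((3 * X : ℕ) : ℝ) := by rw [Real.log_pow]; norm_num
    calc (Nat.primeCounting (3 * X) : ℝ) * Real.log ((8 * X ^ 3 + 2 : ℕ) : ℝ)
        ≤ (Nat.primeCounting (3 * X) : ℝ) * (3 * Real.log ((3 * X : ℕ) : ℝ)) := by gcongr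
      _ = 3 * ((Nat.primeCounting (3 * X) : ℝ) * Real.log ((3 * X : ℕ) : ℝ)) := by ring
      _ ≤ 3 * (5 * ((3 * X : ℕ) : ℝ)) := by gcongr
      _ = 45 * X := by push_cast; ring
  -- combine
  have hper : ∀ p ∈ s, Real.log p * ∑ e ∈ Ico 1 (8 * X ^ 3 + 3),
        (#{n ∈ Ioc X (2 * X) | p ^ e ∣ n ^ 3 + 2} : ℝ) ≤
      X * (ν p * Real.log p / p) + 2 * (ν p * Real.log p)
        + 3 * X * (Real.log p / (p * (p - 1))) + 6 * Real.log ((8 * X ^ 3 + 2 : ℕ) : ℝ) :=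
    fun p hp => log_mul_sum_card_le X (Nat.mem_primesLE.1 hp).2
  have hsplit : ∑ p ∈ s, (X * (ν p * Real.log p / p) + 2 * (ν p * Real.log p)
        + 3 * X * (Real.log p / (p * (p - 1))) + 6 * Real.log ((8 * X ^ 3 + 2 : ℕ) : ℝ)) =
      X * ∑ p ∈ s, ν p * Real.log p / p + 2 * ∑ p ∈ s, ν p * Real.log p
        + 3 * X * ∑ p ∈ s, Real.log p / (p * (p - 1))
        + 6 * ((#s : ℝ) * Real.log ((8 * X ^ 3 + 2 : ℕ) : ℝ)) := by
    rw [sum_add_distrib, sum_add_distrib, sum_add_distrib, ← mul_sum, ← mul_sum, ← mul_sum,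
      sum_const, nsmul_eq_mul]
    ring
  have hXA : (X : ℝ) * ∑ p ∈ s, ν p * Real.log p / p ≤ X * (Real.log X + (Real.log 3 + K)) :=
    mul_le_mul_of_nonneg_left hA hX0.le
  have hXC : 3 * (X : ℝ) * ∑ p ∈ s, Real.log p / (p * (p - 1)) ≤ 3 * X * 2 :=
    mul_le_mul_of_nonneg_left hCs (by positivity)
  have hC' : 0 ≤ C * X / Real.log 2 ^ 2 := by positivity
  calc ∑ p ∈ s, Real.log p * ∑ e ∈ Ico 1 (8 * X ^ 3 + 3),
          (#{n ∈ Ioc X (2 * X) | p ^ e ∣ n ^ 3 + 2} : ℝ)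
      ≤ ∑ p ∈ s, (X * (ν p * Real.log p / p) + 2 * (ν p * Real.log p)
          + 3 * X * (Real.log p / (p * (p - 1))) + 6 * Real.log ((8 * X ^ 3 + 2 : ℕ) : ℝ)) :=
        sum_le_sum hper
    _ ≤ X * Real.log X + (Real.log 3 + K + 6 * C / Real.log 2 ^ 2 + 282) * X := by
        rw [hsplit]
        have e1 : (Real.log 3 + K + 6 * C / Real.log 2 ^ 2 + 282) * X =
            X * (Real.log 3 + K) + 6 * (C * X / Real.log 2 ^ 2) + 282 * X := by ring
        have e2 : 3 * C * (X : ℝ) / Real.log 2 ^ 2 = 3 * (C * X / Real.log 2 ^ 2) := by ring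
        rw [e1]
        rw [e2] at hB
        nlinarith [hXA, hB, hXC, hD, hX0]

end Literature.NumberTheory.Sieve.LargestPrimeFactorCubic
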